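import Summits.ResolutionOfSingularities.ResolutionOfSingularities.Theorems.EquisingularLiftEquisingularLiftNatTowerBTransportFour
import Summits.ResolutionOfSingularities.ResolutionOfSingularities.Theorems.EquisingularLiftEquisingularLiftNatExactShadowPlanar
import HarnessLib

/-!
# [OURS · L1 W4.5(b) · EL♮(3) · T23-A‴ (U6)] DOWNSTAIRS BOOKKEEPING OF THE PLANE LISTS THROUGH AN IN-CARRIER POINT STEP:
# `TCPlus.planes_menu_bookkeeping` / `TCPlus.modelless_menu_bookkeeping` — the two conjuncts `(∀ P ∈ Ps, IsClosed P ∧ ¬ T ⊆ P)` and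
# `(∀ M ∈ Ms, IsClosed M ∧ ¬ T ⊆ M)` that res-L1-w45b-stub-4's V10⁗ INNER invariant carries next to `TCPlus.InvSL` / `TCPlus.InvS₀L` step under
# res-L1-w45b-lead-2's `InCarrierReachKSs` menus (0c6a341d172f5c17): `Ps′ ⊆ {υ₁⁻¹{y}} ∪ {St P | P ∈ Ps, y ∉ P}`, `Ms′ ⊆ {St F | F ∈ Ps ++ Ms}`

res-type-027 g18 ((U6) owner), brick (F8, pure topology). OURS; NOT a statement of any manuscript ([Hironaka2017] is a candidate under adjudication,
nothing of it is asserted); AI-written, weaker than expert review. No `sorry`; standard axioms; DEF-FREE; `--supports stmt-ResolutionOfSingularities-20148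
--as helper`. Over res-L1-w45b-stub-2's `not_closure_preimage_diff_subset` / `Tower.ns_transport` (…NatTowerBPointSteps / …NatTowerBTransportFour) and the
`hTnew` argument of res-type-027's `Tower.invB₄_pointStep` (p625638). [cite: Liu2002, Thm. 8.1.19] [cite: GortzWedhorn2020, Prop. 13.91]
-/

set_option linter.dupNamespace false -- mandated namespace `Summit.<Summit>.<Problem>` of this single-conjunct summit

noncomputable section

open CategoryTheory CategoryTheory.Limits AlgebraicGeometry TopologicalSpace Topology IsLocalRing
open Literature.AlgebraicGeometry.Resolution
open AlgebraicGeometry.Scheme.IdealSheafData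

namespace Summit.ResolutionOfSingularities.ResolutionOfSingularities.Cruxes.EquisingularLiftNat.Sections.TCPlus

variable {G G₂ : Scheme.{0}} [IsLocallyNoetherian G] {y : G} (hy : IsClosed ({y} : Set G)) {υ₁ : G₂ ⟶ G}
  (hυ₁ : IsBlowup υ₁ (vanishingIdeal ⟨{y}, hy⟩)) {T : Set G} (hTirr : IsIrreducible T) (hTy : ¬ T ⊆ {y})

include hυ₁ hTirr hTy

omit hTirr in
/-- **The new running curve is not inside the new plane**: `closure υ₁⁻¹(T ∖ {y}) ⊄ υ₁⁻¹{y}` (a point of `T` off `y` lifts).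
[OURS · pure topology; the `hTnew` argument of `Tower.invB₄_pointStep`] -/
theorem not_closure_preimage_diff_subset_newPlane : ¬ closure (υ₁ ⁻¹' (T \ {y})) ⊆ υ₁ ⁻¹' {y} := by
  obtain ⟨t, htT, htne⟩ := Set.not_subset.mp hTy
  have htJ : t ∉ ((vanishingIdeal ⟨{y}, hy⟩ : G.IdealSheafData).support : Set G) := by
    rw [Scheme.IdealSheafData.coe_support_vanishingIdeal]; exact htne
  obtain ⟨t₂, ht₂⟩ := exists_preimage_of_not_mem_support υ₁ _ hυ₁ htJ
  intro hsub
  have h1 : t₂ ∈ closure (υ₁ ⁻¹' (T \ {y})) := subset_closure (by rw [Set.mem_preimage, ht₂]; exact ⟨htT, htne⟩)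
  have h2 := hsub h1
  rw [Set.mem_preimage, ht₂] at h2
  exact htne h2

/-- **Bookkeeping of the model-carrying plane list through an in-carrier point step** (menu `Ps′ ⊆ {υ₁⁻¹{y}} ∪ {St P | P ∈ Ps, y ∉ P}`): every new
plane is closed and does not contain the new running curve. [OURS · pure topology] -/
theorem planes_menu_bookkeeping {Ps : List (Set G)} (hPs : ∀ P ∈ Ps, IsClosed P ∧ ¬ T ⊆ P) {Ps' : List (Set G₂)}
    (hPs' : ∀ P' ∈ Ps', P' = υ₁ ⁻¹' {y} ∨ ∃ P ∈ Ps, y ∉ P ∧ P' = closure (υ₁ ⁻¹' (P \ {y}))) :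
    ∀ P' ∈ Ps', IsClosed P' ∧ ¬ closure (υ₁ ⁻¹' (T \ {y})) ⊆ P' := by
  intro P' hP'
  rcases hPs' P' hP' with rfl | ⟨P, hP, -, rfl⟩
  · exact ⟨hy.preimage υ₁.continuous, not_closure_preimage_diff_subset_newPlane hy hυ₁ hTy⟩
  · exact ⟨isClosed_closure, not_closure_preimage_diff_subset hυ₁ hTirr (hPs P hP).1 hy (hPs P hP).2 hTy
      (Scheme.IdealSheafData.coe_support_vanishingIdeal _).le⟩

/-- **Bookkeeping of the model-less plane list through an in-carrier point step** (menu `Ms′ ⊆ {St F | F ∈ Ps ++ Ms}`): res-L1-w45b-stub-2's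
`Tower.ns_transport` at `Zc := {y}`. [OURS · pure topology] -/
theorem modelless_menu_bookkeeping {Ps Ms : List (Set G)} (hPs : ∀ P ∈ Ps, IsClosed P ∧ ¬ T ⊆ P) (hMs : ∀ M ∈ Ms, IsClosed M ∧ ¬ T ⊆ M)
    {Ms' : List (Set G₂)} (hMs' : ∀ M' ∈ Ms', ∃ F ∈ Ps ++ Ms, M' = closure (υ₁ ⁻¹' (F \ {y}))) :
    ∀ M' ∈ Ms', IsClosed M' ∧ ¬ closure (υ₁ ⁻¹' (T \ {y})) ⊆ M' :=
  Tower.ns_transport hυ₁ hTirr hy hTy (Scheme.IdealSheafData.coe_support_vanishingIdeal _).le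
    (fun F hF => by
      rcases List.mem_append.mp hF with h | h
      · exact hPs F h
      · exact hMs F h) hMs'

end Summit.ResolutionOfSingularities.ResolutionOfSingularities.Cruxes.EquisingularLiftNat.Sections.TCPlus

end
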